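import Literature.NumberTheory.Transcendental.SqrtSevenLValueIdentity
import Literature.NumberTheory.Transcendental.BlochWignerDilogSeriesProofs
import Literature.NumberTheory.Transcendental.BlochWignerCircle
import Literature.NumberTheory.Transcendental.SqrtSevenCertificate
import HarnessLib

/-!
# The √7 identity: elementary reductions (proofs)

Sibling proof file of `SqrtSevenLValueIdentity.lean` (Bailey–Borwein–Broadhurst–Zudilin 2010, §5).
This file proves the ELEMENTARY half of the printed proof of eq. (clausen), namely the passage
`ζ_{ℚ(√−7)}(2) = ζ(2) L₋₇(2)` ↔ Clausen values at `2πk/7` (loc. cit. eq. (zagier1) and the first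
line of (zagier) = Zagier 1986 eq. (4)–(5)): with `Cl₂(θ) = Σ_{n ≥ 1} sin(nθ)/n²`,

  `L₋₇(2) = (2/√7) · (Cl₂(2π/7) + Cl₂(4π/7) − Cl₂(6π/7))`,

via the Gauss sum of the quadratic character mod `7`, `Σ_{k=1}^{6} (k/7) ζ₇^k = i√7`
(`ζ₇ = e^{2πi/7}`), proved here from `g² = −7` (a polynomial identity modulo `ζ₇⁷ = 1`,
`1 + ζ₇ + ⋯ + ζ₇⁶ = 0`) and the sign `Im g > 0`. Consequently the named fact
`BaileyEtAl2010_sqrt7_clausen` is EQUIVALENT to the pure Clausen-value identity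

  `3 Cl₂(α) − 3 Cl₂(2α) + Cl₂(3α) = (7/2) · (Cl₂(2π/7) + Cl₂(4π/7) − Cl₂(6π/7))`, `α = 2 arctan √7`

(`sqrt7_clausen_iff`), the "highly non-trivial" remaining part (loc. cit. p. 7: Zagier's (5) = (6))
being NOT proved in this file.

## References

* D. H. Bailey, J. M. Borwein, D. Broadhurst, W. Zudilin, *Experimental mathematics and
  mathematical physics*, Contemp. Math. 517 (2010), §5, eqs. (clausen), (zagier), (zagier1)
  (arXiv:1005.0414, p. 7). [BaileyEtAl2010]
* D. Zagier, *Hyperbolic manifolds and special values of Dedekind zeta-functions*, Invent. Math.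
  83 (1986) 285–301, eqs. (4), (5) p. 287. [Zagier1986]
-/

noncomputable section

namespace Literature.NumberTheory.Transcendental

namespace SqrtSeven

open Real

/-! ### The seventh root of unity and the quadratic Gauss sum mod 7 -/

/-- `ζ₇ = e^{2πi/7}` (local notation, so that this file stays definition-free). -/
local notation "ζ₇" => Complex.exp (2 * Real.pi * Complex.I / 7)

/-- `ζ₇^m = e^{2πim/7}`. [folklore] -/
theorem ζ₇_pow_eq_exp (m : ℕ) : ζ₇ ^ m = Complex.exp ((2 * Real.pi * m / 7 : ℝ) * Complex.I) := by
  rw [← Complex.exp_nat_mul]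
  congr 1
  push_cast
  ring

/-- `Im ζ₇^m = sin(2πm/7)`. [folklore] -/
theorem ζ₇_pow_im (m : ℕ) : (ζ₇ ^ m).im = Real.sin (2 * Real.pi * m / 7) := by
  rw [ζ₇_pow_eq_exp, Complex.exp_ofReal_mul_I_im]

/-- `ζ₇⁷ = 1`. [folklore] -/
theorem ζ₇_pow_seven : ζ₇ ^ 7 = 1 := by
  rw [ζ₇_pow_eq_exp, Complex.exp_eq_one_iff]
  exact ⟨1, by push_cast; ring⟩

/-- `ζ₇ ≠ 1`. [folklore] -/
theorem ζ₇_ne_one : ζ₇ ≠ 1 := by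
  intro h
  rw [Complex.exp_eq_one_iff] at h
  obtain ⟨n, hn⟩ := h
  have h1 : (2 * Real.pi * Complex.I) * (1 - 7 * n) = 0 := by linear_combination 7 * hn
  have h2 : (2 * Real.pi * Complex.I) ≠ 0 := by simp [Real.pi_ne_zero, Complex.I_ne_zero]
  have h3 : (1 : ℂ) - 7 * n = 0 := (mul_eq_zero.1 h1).resolve_left h2
  have h4 : (7 * n : ℤ) = 1 := by exact_mod_cast (sub_eq_zero.1 h3).symm
  omega

/-- `ζ₇^n = ζ₇^(n mod 7)`. [folklore] -/
theorem ζ₇_pow_mod (n : ℕ) : ζ₇ ^ n = ζ₇ ^ (n % 7) := by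
  conv_lhs => rw [← Nat.mod_add_div n 7, pow_add, pow_mul, ζ₇_pow_seven, one_pow, mul_one]

/-- `1 + ζ + ⋯ + ζ⁶ = 0`. [folklore] -/
theorem geom_sum_ζ₇ : 1 + ζ₇ + ζ₇ ^ 2 + ζ₇ ^ 3 + ζ₇ ^ 4 + ζ₇ ^ 5 + ζ₇ ^ 6 = 0 := by
  have h : (1 + ζ₇ + ζ₇ ^ 2 + ζ₇ ^ 3 + ζ₇ ^ 4 + ζ₇ ^ 5 + ζ₇ ^ 6) * (ζ₇ - 1) = 0 := by
    linear_combination ζ₇_pow_seven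
  exact (mul_eq_zero.1 h).resolve_right (sub_ne_zero.2 ζ₇_ne_one)

/-- The quadratic Gauss sum mod 7, `g = Σ_{k=1}^{6} (k/7) ζ₇^k = ζ + ζ² + ζ⁴ − ζ³ − ζ⁵ − ζ⁶`
(local notation). -/
local notation "gauss₇" => (ζ₇ + ζ₇ ^ 2 + ζ₇ ^ 4 - ζ₇ ^ 3 - ζ₇ ^ 5 - ζ₇ ^ 6)

/-- `g² = −7`. [folklore] -/
theorem gauss₇_sq : gauss₇ ^ 2 = -7 := by
  have h7 := ζ₇_pow_seven
  have hg := geom_sum_ζ₇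
  linear_combination (-6 + ζ₇ - ζ₇ ^ 3 + 2 * ζ₇ ^ 4 + ζ₇ ^ 5) * h7 + hg

/-- `Im g = 2 (sin(2π/7) + sin(4π/7) − sin(6π/7)) > 0`. [folklore] -/
theorem gauss₇_im_pos : 0 < (gauss₇).im := by
  have him : (gauss₇).im = Real.sin (2 * π * 1 / 7) + Real.sin (2 * π * 2 / 7)
      + Real.sin (2 * π * 4 / 7) - Real.sin (2 * π * 3 / 7) - Real.sin (2 * π * 5 / 7)
      - Real.sin (2 * π * 6 / 7) := by
    simp only [Complex.sub_im, Complex.add_im]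
    rw [← pow_one ζ₇, ← pow_mul, ← pow_mul, ← pow_mul, ← pow_mul, ← pow_mul]
    simp only [ζ₇_pow_im]
    push_cast
    ring_nf
  -- sin(2π·4/7) = −sin(2π·3/7), sin(2π·5/7) = −sin(2π·2/7), sin(2π·6/7) = −sin(2π/7)
  have e4 : Real.sin (2 * π * 4 / 7) = - Real.sin (2 * π * 3 / 7) := by
    rw [show (2 * π * 4 / 7 : ℝ) = -(2 * π * 3 / 7) + 2 * π by ring, Real.sin_add_two_pi,
      Real.sin_neg]
  have e5 : Real.sin (2 * π * 5 / 7) = - Real.sin (2 * π * 2 / 7) := by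
    rw [show (2 * π * 5 / 7 : ℝ) = -(2 * π * 2 / 7) + 2 * π by ring, Real.sin_add_two_pi,
      Real.sin_neg]
  have e6 : Real.sin (2 * π * 6 / 7) = - Real.sin (2 * π * 1 / 7) := by
    rw [show (2 * π * 6 / 7 : ℝ) = -(2 * π * 1 / 7) + 2 * π by ring, Real.sin_add_two_pi,
      Real.sin_neg]
  -- sin(2π·3/7) = sin(π/7) < sin(3π/7) = sin(2π·2/7); sin(2π/7) > 0
  have e3 : Real.sin (2 * π * 3 / 7) = Real.sin (π / 7) := by
    rw [← Real.sin_pi_sub]; congr 1; ring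
  have e2 : Real.sin (2 * π * 2 / 7) = Real.sin (3 * π / 7) := by
    rw [← Real.sin_pi_sub]; congr 1; ring
  have h1 : 0 < Real.sin (2 * π * 1 / 7) :=
    Real.sin_pos_of_pos_of_lt_pi (by positivity) (by nlinarith [Real.pi_pos])
  have hlt : Real.sin (π / 7) < Real.sin (3 * π / 7) := by
    apply Real.strictMonoOn_sin
    · constructor <;> nlinarith [Real.pi_pos]
    · constructor <;> nlinarith [Real.pi_pos]
    · nlinarith [Real.pi_pos]
  rw [him, e4, e5, e6, e3, e2]
  nlinarith

/-- **The sign of the Gauss sum**: `Σ_{k=1}^{6} (k/7) ζ₇^k = i√7`. [folklore] -/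
theorem gauss₇_eq : gauss₇ = Real.sqrt 7 * Complex.I := by
  have hs : ((Real.sqrt 7 : ℝ) : ℂ) ^ 2 = 7 := by
    rw [← Complex.ofReal_pow, Real.sq_sqrt (by norm_num)]; norm_num
  have h : (gauss₇ - Real.sqrt 7 * Complex.I) * (gauss₇ + Real.sqrt 7 * Complex.I) = 0 := by
    linear_combination gauss₇_sq - ((Real.sqrt 7 : ℝ) : ℂ) ^ 2 * Complex.I_sq + hs
  rcases mul_eq_zero.1 h with h | h
  · exact sub_eq_zero.1 h
  · exfalso
    have hi : (gauss₇).im = - Real.sqrt 7 := by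
      have := congrArg Complex.im (eq_neg_of_add_eq_zero_left h)
      simpa using this
    have := gauss₇_im_pos
    rw [hi] at this
    have h7 : 0 ≤ Real.sqrt 7 := Real.sqrt_nonneg 7
    linarith

/-- `Im g = √7`. [folklore] -/
theorem gauss₇_im : (gauss₇).im = Real.sqrt 7 := by
  rw [gauss₇_eq]; simp

/-! ### Character sums `Σ_k (k/7) ζ₇^{kr} = (r/7) g` -/

/-- For `r < 7`: `Σ_{k=0}^{6} (k/7) ζ₇^{kr} = (r/7) · g`. [folklore] -/
theorem charSum_eq (r : ℕ) (hr : r < 7) :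
    ∑ k ∈ Finset.range 7, ((jacobiSym k 7 : ℤ) : ℂ) * ζ₇ ^ (k * r) = (jacobiSym r 7 : ℂ) * gauss₇ := by
  have h7 := ζ₇_pow_seven
  interval_cases r
  · simp only [Finset.sum_range_succ, Finset.sum_range_zero, mul_zero, pow_zero, mul_one, zero_add]
    norm_num
  · simp only [Finset.sum_range_succ, Finset.sum_range_zero, zero_add, mul_one]
    norm_num
    ring
  · simp only [Finset.sum_range_succ, Finset.sum_range_zero, zero_add]
    norm_num
    linear_combination (ζ₇ - ζ₇ ^ 3 - ζ₇ ^ 5) * h7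
  · simp only [Finset.sum_range_succ, Finset.sum_range_zero, zero_add]
    norm_num
    linear_combination (-ζ₇ - ζ₇ ^ 2 - ζ₇ ^ 4 + ζ₇ ^ 5 - ζ₇ ^ 8 - ζ₇ ^ 11) * h7
  · simp only [Finset.sum_range_succ, Finset.sum_range_zero, zero_add]
    norm_num
    linear_combination (ζ₇ + ζ₇ ^ 2 - ζ₇ ^ 3 - ζ₇ ^ 5 - ζ₇ ^ 6 + ζ₇ ^ 9 - ζ₇ ^ 10 - ζ₇ ^ 13
      - ζ₇ ^ 17) * h7
  · simp only [Finset.sum_range_succ, Finset.sum_range_zero, zero_add]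
    norm_num
    linear_combination (-ζ₇ - ζ₇ ^ 2 + ζ₇ ^ 3 - ζ₇ ^ 4 + ζ₇ ^ 6 - ζ₇ ^ 8 - ζ₇ ^ 9 - ζ₇ ^ 11
      + ζ₇ ^ 13 - ζ₇ ^ 16 - ζ₇ ^ 18 - ζ₇ ^ 23) * h7
  · simp only [Finset.sum_range_succ, Finset.sum_range_zero, zero_add]
    norm_num
    linear_combination (-ζ₇ - ζ₇ ^ 2 + ζ₇ ^ 3 - ζ₇ ^ 4 + ζ₇ ^ 5 - ζ₇ ^ 8 - ζ₇ ^ 9 + ζ₇ ^ 10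
      - ζ₇ ^ 11 - ζ₇ ^ 15 - ζ₇ ^ 16 + ζ₇ ^ 17 - ζ₇ ^ 22 - ζ₇ ^ 23 - ζ₇ ^ 29) * h7

/-- **Fourier expansion of the Legendre symbol mod 7** (imaginary part of the Gauss-sum identity):
for every `n`, `(n/7) · √7 = Σ_{k=0}^{6} (k/7) sin(2πkn/7)`. [folklore] -/
theorem jacobiSym_mul_sqrt_seven (n : ℕ) :
    (jacobiSym n 7 : ℝ) * Real.sqrt 7 =
      ∑ k ∈ Finset.range 7, (jacobiSym k 7 : ℝ) * Real.sin (2 * π * (k * n : ℕ) / 7) := by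
  have hr : n % 7 < 7 := Nat.mod_lt _ (by norm_num)
  -- the complex identity at `r = n % 7`
  have hC : ∑ k ∈ Finset.range 7, ((jacobiSym k 7 : ℤ) : ℂ) * ζ₇ ^ (k * n)
      = (jacobiSym n 7 : ℂ) * gauss₇ := by
    have hJ : jacobiSym n 7 = jacobiSym (n % 7 : ℕ) 7 := by
      rw [jacobiSym.mod_left (n : ℤ) 7]; push_cast [Int.natCast_mod]; rfl
    rw [hJ, ← charSum_eq (n % 7) hr]
    refine Finset.sum_congr rfl fun k _ => ?_
    rw [ζ₇_pow_mod (k * n), ζ₇_pow_mod (k * (n % 7)), Nat.mul_mod, Nat.mul_mod k (n % 7),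
      Nat.mod_mod]
  -- take imaginary parts
  have := congrArg Complex.im hC
  rw [Complex.im_sum] at this
  simp only [Complex.mul_im, Complex.intCast_re, Complex.intCast_im, zero_mul, add_zero,
    ζ₇_pow_im, gauss₇_eq, Complex.mul_re, Complex.ofReal_re, Complex.I_re,
    mul_zero, Complex.ofReal_im, Complex.I_im, sub_zero] at this
  rw [this]
  ring

/-! ### `L₋₇(2)` in Clausen form -/

/-- Summability of `n ↦ c · sin(θ n)/n²`-type sequences bounded by `|c|/n²`. [folklore] -/
theorem summable_sin_div_sq (c θ : ℝ) :
    Summable fun n : ℕ => c * Real.sin (θ * n) / (n : ℝ) ^ 2 := by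
  have hs : Summable fun n : ℕ => |c| * (1 / (n : ℝ) ^ 2) :=
    (Real.summable_one_div_nat_pow.mpr one_lt_two).mul_left _
  refine Summable.of_norm_bounded hs fun n => ?_
  rw [Real.norm_eq_abs, abs_div, abs_mul, abs_pow, Nat.abs_cast]
  have h1 : |c| * |Real.sin (θ * n)| ≤ |c| * 1 :=
    mul_le_mul_of_nonneg_left (Real.abs_sin_le_one _) (abs_nonneg c)
  calc |c| * |Real.sin (θ * n)| / (n : ℝ) ^ 2 ≤ |c| * 1 / (n : ℝ) ^ 2 :=
        div_le_div_of_nonneg_right h1 (by positivity)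
    _ = |c| * (1 / (n : ℝ) ^ 2) := by ring

/-- **`L₋₇(2)` in Clausen form** (the elementary first equality of BBBZ eq. (zagier) combined with
eq. (zagier1); Zagier 1986 eqs. (4)–(5)):
`L₋₇(2) = (2/√7) (Cl₂(2π/7) + Cl₂(4π/7) − Cl₂(6π/7))`, `Cl₂(θ) = Σ_{n≥1} sin(nθ)/n²`.
[cite: BaileyEtAl2010, §5 eq. (zagier)–(zagier1)] -/
theorem LMinusSevenTwo_eq_clausen :
    LMinusSevenTwo = 2 / Real.sqrt 7 *
      ((∑' n : ℕ, Real.sin (n * (2 * π / 7)) / (n : ℝ) ^ 2)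
        + (∑' n : ℕ, Real.sin (n * (4 * π / 7)) / (n : ℝ) ^ 2)
        - (∑' n : ℕ, Real.sin (n * (6 * π / 7)) / (n : ℝ) ^ 2)) := by
  have h7 : Real.sqrt 7 ≠ 0 := Real.sqrt_ne_zero'.2 (by norm_num)
  -- pointwise Fourier expansion of the summand
  have hpt : ∀ n : ℕ, ((jacobiSym (n : ℤ) 7 : ℤ) : ℝ) / (n : ℝ) ^ 2 =
      ∑ k ∈ Finset.range 7, (jacobiSym k 7 : ℝ) / Real.sqrt 7 *
        Real.sin ((2 * π * k / 7) * n) / (n : ℝ) ^ 2 := by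
    intro n
    have := jacobiSym_mul_sqrt_seven n
    rw [← eq_div_iff h7] at this
    rw [this, Finset.sum_div, Finset.sum_div]
    refine Finset.sum_congr rfl fun k _ => ?_
    push_cast
    ring_nf
  -- pulling constants out of the Clausen sums
  have pull : ∀ (a θ : ℝ), (∑' n : ℕ, a * Real.sin (θ * n) / (n : ℝ) ^ 2)
      = a * ∑' n : ℕ, Real.sin (θ * n) / (n : ℝ) ^ 2 := by
    intro a θ
    rw [← tsum_mul_left]
    exact tsum_congr fun n => by ring
  -- folding `k = 4, 5, 6` onto `k = 3, 2, 1`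
  have fold : ∀ (a b : ℝ), a + b = 2 * π →
      (∑' n : ℕ, Real.sin (a * n) / (n : ℝ) ^ 2) = -(∑' n : ℕ, Real.sin (b * n) / (n : ℝ) ^ 2) := by
    intro a b hab
    rw [← tsum_neg]
    refine tsum_congr fun n => ?_
    have : a * n = -(b * n) + n * (2 * π) := by rw [← hab]; ring
    rw [this, Real.sin_add_nat_mul_two_pi, Real.sin_neg, neg_div]
  have f4 := fold (2 * π * 4 / 7) (2 * π * 3 / 7) (by ring)
  have f5 := fold (2 * π * 5 / 7) (2 * π * 2 / 7) (by ring)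
  have f6 := fold (2 * π * 6 / 7) (2 * π * 1 / 7) (by ring)
  -- the three Clausen values of the statement, angles normalised
  have hc1 : (∑' n : ℕ, Real.sin (n * (2 * π / 7)) / (n : ℝ) ^ 2)
      = ∑' n : ℕ, Real.sin (2 * π * 1 / 7 * n) / (n : ℝ) ^ 2 := tsum_congr fun n => by ring_nf
  have hc2 : (∑' n : ℕ, Real.sin (n * (4 * π / 7)) / (n : ℝ) ^ 2)
      = ∑' n : ℕ, Real.sin (2 * π * 2 / 7 * n) / (n : ℝ) ^ 2 := tsum_congr fun n => by ring_nf
  have hc3 : (∑' n : ℕ, Real.sin (n * (6 * π / 7)) / (n : ℝ) ^ 2)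
      = ∑' n : ℕ, Real.sin (2 * π * 3 / 7 * n) / (n : ℝ) ^ 2 := tsum_congr fun n => by ring_nf
  have j0 : jacobiSym 0 7 = 0 := by norm_num
  have j1 : jacobiSym 1 7 = 1 := by norm_num
  have j2 : jacobiSym 2 7 = 1 := by norm_num
  have j3 : jacobiSym 3 7 = -1 := by norm_num
  have j4 : jacobiSym 4 7 = 1 := by norm_num
  have j5 : jacobiSym 5 7 = -1 := by norm_num
  have j6 : jacobiSym 6 7 = -1 := by norm_num
  rw [hc1, hc2, hc3]
  unfold LMinusSevenTwo
  rw [tsum_congr hpt, Summable.tsum_finsetSum (fun k _ => summable_sin_div_sq _ _)]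
  simp only [Finset.sum_range_succ, Finset.sum_range_zero, zero_add, pull, Nat.cast_zero,
    Nat.cast_one, Nat.cast_ofNat, j0, j1, j2, j3, j4, j5, j6, Int.cast_zero, Int.cast_one,
    Int.cast_neg, f4, f5, f6]
  field_simp
  ring

/-- **Reduction of the √7 identity to a pure Clausen-value identity.** The named fact
`BaileyEtAl2010_sqrt7_clausen` (`3 Cl₂(α) − 3 Cl₂(2α) + Cl₂(3α) = (7√7/4) L₋₇(2)`) is equivalent to
`3 Cl₂(α) − 3 Cl₂(2α) + Cl₂(3α) = (7/2)(Cl₂(2π/7) + Cl₂(4π/7) − Cl₂(6π/7))`, `α = 2 arctan √7`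
(the form of Borwein–Broadhurst 1998 recorded in BBBZ; what remains is Zagier's (5) = (6)).
[cite: BaileyEtAl2010, §5 eqs. (clausen), (zagier), (zagier1)] -/
theorem sqrt7_clausen_iff :
    BaileyEtAl2010_sqrt7_clausen ↔
      3 * (∑' n : ℕ, Real.sin (n * (2 * Real.arctan (Real.sqrt 7))) / (n : ℝ) ^ 2)
        - 3 * (∑' n : ℕ, Real.sin (n * (2 * (2 * Real.arctan (Real.sqrt 7)))) / (n : ℝ) ^ 2)
        + (∑' n : ℕ, Real.sin (n * (3 * (2 * Real.arctan (Real.sqrt 7)))) / (n : ℝ) ^ 2)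
      = 7 / 2 * ((∑' n : ℕ, Real.sin (n * (2 * π / 7)) / (n : ℝ) ^ 2)
          + (∑' n : ℕ, Real.sin (n * (4 * π / 7)) / (n : ℝ) ^ 2)
          - (∑' n : ℕ, Real.sin (n * (6 * π / 7)) / (n : ℝ) ^ 2)) := by
  have h7 : Real.sqrt 7 ≠ 0 := Real.sqrt_ne_zero'.2 (by norm_num)
  unfold BaileyEtAl2010_sqrt7_clausen
  dsimp only
  rw [LMinusSevenTwo_eq_clausen]
  have key : ∀ X : ℝ, 7 * Real.sqrt 7 / 4 * (2 / Real.sqrt 7 * X) = 7 / 2 * X := by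
    intro X; field_simp; ring
  rw [key]

end SqrtSeven

/-! ## The `√7` identity itself (appended by the unit discharging `BaileyEtAl2010_sqrt7_identity`)

The "highly non-trivial" remaining part (Zagier's (5) = (6)) is supplied by the explicit
five-term certificate `SqrtSevenCertificate.sqrt7_certificate`
(`6D(u) − 6D(u²) + 2D(u³) = 7(D(ζ) + D(ζ²) + D(ζ⁴))`, `D` the Bloch–Wigner dilogarithm,
`u = (−1 + ζ + ζ² + ζ⁴)/2`), the arctangent integral is `(3D(u) − 3D(u²) + D(u³))/6` with
`u = e^{2i arctan √7}` (`integral_log_tan_sqrt_seven`, file `BlochWignerCircle`), and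
`D(e^{iθ}) = Cl₂(θ)` (`Dilog.blochWignerDilog_exp_mul_I`, file `BlochWignerDilogSeriesProofs`)
turns `LMinusSevenTwo_eq_clausen` above into `L₋₇(2) = (2/√7)(D(ζ₇) + D(ζ₇²) + D(ζ₇⁴))`. -/

namespace SqrtSeven

open scoped ComplexConjugate

/-- `ζ̄₇ = ζ₇⁶`. [folklore] -/
theorem zeta7_conj : conj (Complex.exp (2 * Real.pi * Complex.I / 7)) =
    Complex.exp (2 * Real.pi * Complex.I / 7) ^ 6 := by
  rw [← Complex.exp_conj, ← Complex.exp_nat_mul, map_div₀, map_mul, map_mul, Complex.conj_ofReal,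
    Complex.conj_I, map_ofNat, map_ofNat,
    show ((6 : ℕ) : ℂ) * (2 * Real.pi * Complex.I / 7) = 2 * Real.pi * Complex.I +
      2 * Real.pi * -Complex.I / 7 by push_cast; ring, Complex.exp_add, Complex.exp_two_pi_mul_I,
    one_mul]

/-- The Gauss period `ζ₇ + ζ₇² + ζ₇⁴ = (−1 + i√7)/2` (from `gauss₇ = i√7` and `1 + ζ + ⋯ + ζ⁶ = 0`).
[folklore] -/
theorem eta_eq : Complex.exp (2 * Real.pi * Complex.I / 7) + Complex.exp (2 * Real.pi * Complex.I / 7) ^ 2 +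
    Complex.exp (2 * Real.pi * Complex.I / 7) ^ 4 = ⟨-1 / 2, Real.sqrt 7 / 2⟩ := by
  have hg := gauss₇_eq
  have hs := geom_sum_ζ₇
  set ζ := Complex.exp (2 * Real.pi * Complex.I / 7)
  have h2 : 2 * (ζ + ζ ^ 2 + ζ ^ 4) = -1 + Real.sqrt 7 * Complex.I := by
    linear_combination hg + hs
  have hre := congrArg Complex.re h2
  have him := congrArg Complex.im h2
  simp only [Complex.mul_re, Complex.re_ofNat, Complex.im_ofNat, zero_mul, sub_zero,
    Complex.add_re, Complex.neg_re, Complex.one_re, Complex.ofReal_re, Complex.I_re, mul_zero,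
    Complex.ofReal_im, Complex.I_im, Complex.mul_im, zero_add, add_zero, Complex.add_im,
    Complex.neg_im, Complex.one_im, neg_zero, mul_one] at hre him
  apply Complex.ext
  · simp only [Complex.add_re]; linarith
  · simp only [Complex.add_im]; linarith

/-- **`L₋₇(2) = (2/√7)(D(ζ₇) + D(ζ₇²) + D(ζ₇⁴))`** with the Bloch–Wigner dilogarithm `D`
(`D(e^{iθ}) = Cl₂(θ)` applied to `LMinusSevenTwo_eq_clausen`; `Cl₂(8π/7) = −Cl₂(6π/7)`).
[cite: BaileyEtAl2010, §5 eqs. (zagier), (zagier1)] -/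
theorem LMinusSevenTwo_eq_blochWigner :
    LMinusSevenTwo = 2 / Real.sqrt 7 *
      (blochWignerDilog (Complex.exp (2 * Real.pi * Complex.I / 7)) +
        blochWignerDilog (Complex.exp (2 * Real.pi * Complex.I / 7) ^ 2) +
        blochWignerDilog (Complex.exp (2 * Real.pi * Complex.I / 7) ^ 4)) := by
  rw [LMinusSevenTwo_eq_clausen, ← pow_one (Complex.exp (2 * Real.pi * Complex.I / 7)),
    ← pow_mul, ← pow_mul, ζ₇_pow_eq_exp, ζ₇_pow_eq_exp, ζ₇_pow_eq_exp,
    Dilog.blochWignerDilog_exp_mul_I, Dilog.blochWignerDilog_exp_mul_I,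
    Dilog.blochWignerDilog_exp_mul_I]
  have e1 : (fun n : ℕ => Real.sin (n * (2 * Real.pi * ((1 : ℕ) : ℝ) / 7)) / (n : ℝ) ^ 2) =
      fun n : ℕ => Real.sin (n * (2 * Real.pi / 7)) / (n : ℝ) ^ 2 := by
    funext n; norm_num
  have e2 : (fun n : ℕ => Real.sin (n * (2 * Real.pi * ((1 * 2 : ℕ) : ℝ) / 7)) / (n : ℝ) ^ 2) =
      fun n : ℕ => Real.sin (n * (4 * Real.pi / 7)) / (n : ℝ) ^ 2 := by
    funext n; push_cast; ring_nf
  have e4 : (fun n : ℕ => Real.sin (n * (2 * Real.pi * ((1 * 4 : ℕ) : ℝ) / 7)) / (n : ℝ) ^ 2) =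
      fun n : ℕ => -(Real.sin (n * (6 * Real.pi / 7)) / (n : ℝ) ^ 2) := by
    funext n
    rw [show (n : ℝ) * (2 * Real.pi * ((1 * 4 : ℕ) : ℝ) / 7) = n * (2 * Real.pi) - n * (6 * Real.pi / 7) by
      push_cast; ring, Real.sin_nat_mul_two_pi_sub, neg_div]
  rw [e1, e2, e4, tsum_neg]
  ring

end SqrtSeven

/-- **The `√7` identity holds** (Bailey–Borwein–Broadhurst–Zudilin 2010, §5, eq. (arctan)):
`(24/(7√7)) ∫_{π/3}^{π/2} log|(tan t + √7)/(tan t − √7)| dt = L₋₇(2)`. Discharge of the named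
fact `BaileyEtAl2010_sqrt7_identity`. Route: the integral is `(3D(u) − 3D(u²) + D(u³))/6`,
`u = e^{2i arctan √7} = (−3 + i√7)/4 = (−1 + ζ₇ + ζ₇² + ζ₇⁴)/2` (`integral_log_tan_sqrt_seven`,
`exp_two_arctan_sqrt_seven_mul_I`, `SqrtSeven.eta_eq`); `L₋₇(2) = (2/√7)(D(ζ₇) + D(ζ₇²) + D(ζ₇⁴))`
(`SqrtSeven.LMinusSevenTwo_eq_blochWigner`); and the two are linked by the explicit Bloch-group
certificate `SqrtSevenCertificate.sqrt7_certificate` (39 five-term relations of `D` in `ℚ(ζ₇)`),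
which replaces Zagier's (5) = (6) (the volume of `ℍ³/PSL₂(O_{ℚ(√−7)})`) of the printed proof.
[cite: BaileyEtAl2010, §5 eq. (arctan)] -/
theorem BaileyEtAl2010_sqrt7_identity_holds : BaileyEtAl2010_sqrt7_identity := by
  unfold BaileyEtAl2010_sqrt7_identity
  rw [integral_log_tan_sqrt_seven, SqrtSeven.LMinusSevenTwo_eq_blochWigner]
  have hΦ := SqrtSeven.geom_sum_ζ₇
  have hconj := SqrtSeven.zeta7_conj
  have hη := SqrtSeven.eta_eq
  set ζ : ℂ := Complex.exp (2 * Real.pi * Complex.I / 7) with hζ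
  have hu : Complex.exp ((2 * Real.arctan (Real.sqrt 7) : ℝ) * Complex.I) =
      (-(1 / 2 : ℂ) + (1 / 2 : ℂ) * ζ + (1 / 2 : ℂ) * ζ ^ 2 + (1 / 2 : ℂ) * ζ ^ 4) := by
    rw [exp_two_arctan_sqrt_seven_mul_I, show (-(1 / 2 : ℂ) + (1 / 2 : ℂ) * ζ + (1 / 2 : ℂ) * ζ ^ 2 +
      (1 / 2 : ℂ) * ζ ^ 4) = -(1 / 2 : ℂ) + (1 / 2 : ℂ) * (ζ + ζ ^ 2 + ζ ^ 4) by ring, hη]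
    apply Complex.ext
    · norm_num
    · norm_num; ring
  rw [hu]
  have hcert := SqrtSevenCertificate.sqrt7_certificate ζ hΦ hconj
  linear_combination (2 / (7 * Real.sqrt 7)) * hcert

open scoped ComplexConjugate in
/-- **The Clausen form holds too** (Bailey–Borwein–Broadhurst–Zudilin 2010, §5, eq. (clausen)):
`3 Cl₂(α) − 3 Cl₂(2α) + Cl₂(3α) = (7√7/4) L₋₇(2)`, `α = 2 arctan √7`. By `sqrt7_clausen_iff` above
it is the pure Clausen-value identity, i.e. (with `Cl₂(θ) = D(e^{iθ})`,
`Dilog.blochWignerDilog_exp_mul_I`) exactly one half of `SqrtSevenCertificate.sqrt7_certificate`.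
Discharge of the named fact `BaileyEtAl2010_sqrt7_clausen`. [cite: BaileyEtAl2010, §5 eq. (clausen)] -/
theorem BaileyEtAl2010_sqrt7_clausen_holds : BaileyEtAl2010_sqrt7_clausen := by
  rw [SqrtSeven.sqrt7_clausen_iff]
  have hD := Dilog.blochWignerDilog_exp_mul_I
  rw [← hD (2 * Real.arctan (Real.sqrt 7)), ← hD (2 * (2 * Real.arctan (Real.sqrt 7))),
    ← hD (3 * (2 * Real.arctan (Real.sqrt 7))), ← hD (2 * Real.pi / 7), ← hD (4 * Real.pi / 7),
    ← hD (6 * Real.pi / 7)]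
  have hΦ := SqrtSeven.geom_sum_ζ₇
  have hconj := SqrtSeven.zeta7_conj
  have hη := SqrtSeven.eta_eq
  set ζ : ℂ := Complex.exp (2 * Real.pi * Complex.I / 7) with hζ
  -- the three cyclotomic points
  have e1 : Complex.exp ((2 * Real.pi / 7 : ℝ) * Complex.I) = ζ := by
    rw [hζ]; congr 1; push_cast; ring
  have e2 : Complex.exp ((4 * Real.pi / 7 : ℝ) * Complex.I) = ζ ^ 2 := by
    rw [hζ, ← Complex.exp_nat_mul]; congr 1; push_cast; ring
  have e3 : Complex.exp ((6 * Real.pi / 7 : ℝ) * Complex.I) = conj (ζ ^ 4) := by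
    rw [map_pow, hconj, ← pow_mul, show 6 * 4 = 7 * 3 + 3 by norm_num, pow_add, pow_mul,
      SqrtSeven.ζ₇_pow_seven, one_pow, one_mul, hζ, ← Complex.exp_nat_mul]
    congr 1; push_cast; ring
  -- the three points on the `u`-side
  set u : ℂ := Complex.exp ((2 * Real.arctan (Real.sqrt 7) : ℝ) * Complex.I) with hu0
  have f2 : Complex.exp ((2 * (2 * Real.arctan (Real.sqrt 7)) : ℝ) * Complex.I) = u ^ 2 := by
    rw [hu0, ← Complex.exp_nat_mul]; congr 1; push_cast; ring
  have f3 : Complex.exp ((3 * (2 * Real.arctan (Real.sqrt 7)) : ℝ) * Complex.I) = u ^ 3 := by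
    rw [hu0, ← Complex.exp_nat_mul]; congr 1; push_cast; ring
  have hu : u = (-(1 / 2 : ℂ) + (1 / 2 : ℂ) * ζ + (1 / 2 : ℂ) * ζ ^ 2 + (1 / 2 : ℂ) * ζ ^ 4) := by
    rw [hu0, exp_two_arctan_sqrt_seven_mul_I, show (-(1 / 2 : ℂ) + (1 / 2 : ℂ) * ζ +
      (1 / 2 : ℂ) * ζ ^ 2 + (1 / 2 : ℂ) * ζ ^ 4) = -(1 / 2 : ℂ) + (1 / 2 : ℂ) * (ζ + ζ ^ 2 + ζ ^ 4)
      by ring, hη]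
    apply Complex.ext
    · norm_num
    · norm_num; ring
  rw [e1, e2, e3, f2, f3, blochWignerDilog_conj', hu]
  have hcert := SqrtSevenCertificate.sqrt7_certificate ζ hΦ hconj
  linear_combination (1 / 2 : ℝ) * hcert

end Literature.NumberTheory.Transcendental
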